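import Literature.Computability.AlgebraicComplexity.MW21SingNsingComparisonProofs
import Literature.NumberTheory.DiophantineGeometry.DetStabilizerFrobeniusProofs
import HarnessLib

/-!
# The ring of determinantal polynomials is no invariant ring (Makam–Wigderson 2021, Thm. 1.16):
# discharge of `makamWigderson2021_thm_1_16`

Sibling proof file of `Literature/Computability/AlgebraicComplexity/MW21SingularTuplesNullCone.lean`
(cell `val-lit`, cross-ladder typing row X3-MW21), discharging its named fact
`Literature.Computability.AlgebraicComplexity.makamWigderson2021_thm_1_16` (V. Makam, A. Wigderson,
*Singular tuples of matrices is not a null cone (and the symmetries of algebraic varieties)*,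
J. reine angew. Math. **780** (2021) = arXiv:1909.00857, Thm. 1.16, p0007:L3, proof §11 p0028):
"Suppose `n, m ≥ 3`. Then the subring `R = ℂ[{det(∑ᵢ cᵢXᵢ) : cᵢ ∈ ℂ}] ⊆ ℂ[Mat_n^m]` is not the
invariant ring for any linear action of any group `G` on `Mat_n^m`" (the printed proof "works for
every group"). Honest framing: a discharge of a typed published statement; nothing here bears on VP
versus VNP.

## Proof (after §11 of the source, with the reductive-group step replaced by an explicit invariant)

Suppose `ℂ[V]^Γ = D := ℂ[det(∑ cᵢXᵢ)]`. Then every `ρ(γ)` fixes each `det(∑ cᵢXᵢ)`, i.e. lies in the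
group `G_D` of the source. **Prop. 11.1** (`exists_block_of_det_pencil_eq`): such a linear map is
`I_m ⊗ C` with `C` a linear determinant preserver of `Mat_n` — its block `g_{ij} : Xⱼ ↦ (gX)ᵢ`
vanishes for `i ≠ j` and the diagonal blocks coincide, both because `det(A + Y) = det Y` for all
`Y` forces `A = 0` (`eq_zero_of_forall_det_add_eq`, the tree's Marcus–Moyls Lemma 7 argument) and
determinant preservers are bijective (tree, `MarcusMoyls.injective_of_det_eq`). By Frobenius
(tree, `MarcusMoyls.exists_unimodular_sandwich_of_det_eq`) `C` is `X ↦ PXQ` or `X ↦ PXᵀQ` with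
`det P = det Q = 1`. Hence the polynomial `F = det(∑ᵢ Xᵢ ⊗ Tᵢ) · det(∑ᵢ Xᵢ ⊗ Tᵢᵀ)` (for fixed
`2 × 2` blocks `Tᵢ`) is `ρ(γ)`-invariant for every `γ` (a sandwich multiplies each factor by
`(det P det Q)² = 1`, a transposed sandwich moreover swaps the two factors), so `F ∈ ℂ[V]^Γ = D`.
But every element of `D` takes the same value at `0` and at any point of `SING_{n,m}` (the
generators vanish on both), while for the padded `𝔰𝔬₃` tuple `X' ∈ SING_{n,m}` and its certificates
`T` (tree, `exists_mem_SING_det_kronecker_ne_zero`) `F(X') ≠ 0 = F(0)` — contradiction. (The source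
instead identifies the null cone of the reductive group `G_D` with `NSING ⊊ SING`; the invariant `F`
is exactly a function separating the two.) Everything is proved; no definitions are introduced.

## References

* [MakamWigderson2021] V. Makam, A. Wigderson, J. reine angew. Math. 780 (2021) =
  arXiv:1909.00857, Thm. 1.16 (p0007:L3), §11 with Prop. 11.1 (p0028).
* M. Marcus, B. N. Moyls, *Linear transformations on algebras of matrices*, Canad. J. Math. 11
  (1959) (the tree's determinant-preserver engine); G. Frobenius (1897).
-/

noncomputable section

open Matrix

namespace Literature.Computability.AlgebraicComplexity

namespace MakamWigderson

open Literature.NumberTheory.DiophantineGeometry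

variable {n m : ℕ}

/-! ### `det(A + Y) = det Y` for all `Y` forces `A = 0` -/

/-- If `det(A + Y) = det Y` for every `Y` then `A = 0` (Marcus–Moyls' Lemma 7 argument: bring
`A = P·diag(d)·Q` to diagonal form by elementary operations and test against `Y = P·diag(d')·Q`,
`d' = [d = 0]`). [cite: MakamWigderson2021, Prop. 11.1 (proof)] -/
theorem eq_zero_of_forall_det_add_eq {A : Matrix (Fin n) (Fin n) ℂ}
    (hAX : ∀ Y : Matrix (Fin n) (Fin n) ℂ, (A + Y).det = Y.det) : A = 0 := by
  by_contra hA0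
  obtain ⟨L, L', d, hd⟩ := Pivot.exists_list_transvec_mul_diagonal_mul_list_transvec A
  set P := (L.map TransvectionStruct.toMatrix).prod with hP
  set Q := (L'.map TransvectionStruct.toMatrix).prod with hQ
  have hdet' : ∀ v : Fin n → ℂ, (P * diagonal v * Q).det = ∏ i, v i := by
    intro v
    rw [det_mul, det_mul, TransvectionStruct.det_toMatrix_prod L,
      TransvectionStruct.det_toMatrix_prod L', det_diagonal, one_mul, mul_one]
  obtain ⟨i, hi⟩ : ∃ i, d i ≠ 0 := by
    by_contra! h0
    refine hA0 ?_
    have hdiag0 : diagonal d = 0 := by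
      ext i j
      simp [diagonal_apply, h0]
    rw [hd, hdiag0, Matrix.mul_zero, Matrix.zero_mul]
  obtain ⟨d', hd', hd'i⟩ : ∃ d' : Fin n → ℂ, (∀ j, d j + d' j ≠ 0) ∧ d' i = 0 := by
    classical
    refine ⟨fun j => if d j = 0 then 1 else 0, fun j => ?_, by simp [hi]⟩
    dsimp only
    by_cases hdj : d j = 0
    · rw [if_pos hdj, hdj, zero_add]
      exact one_ne_zero
    · rwa [if_neg hdj, add_zero]
  have h := hAX (P * diagonal d' * Q)
  rw [hd, ← Matrix.add_mul, ← Matrix.mul_add, diagonal_add, hdet', hdet'] at h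
  have hl : ∏ j, (d j + d' j) ≠ 0 := Finset.prod_ne_zero_iff.mpr fun j _ => hd' j
  have hr : ∏ j, d' j = 0 := Finset.prod_eq_zero (Finset.mem_univ i) hd'i
  exact hl (h.trans hr)

/-- A linear determinant preserver of `Mat_n` is onto (it is injective by the tree's Marcus–Moyls
Lemma 7). [cite: MakamWigderson2021, Prop. 11.1 (proof)] -/
theorem surjective_of_det_eq {C : Matrix (Fin n) (Fin n) ℂ →ₗ[ℂ] Matrix (Fin n) (Fin n) ℂ}
    (hC : ∀ W, (C W).det = W.det) : Function.Surjective C :=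
  LinearMap.injective_iff_surjective.mp (MarcusMoyls.injective_of_det_eq hC)

/-! ### Prop. 11.1: linear maps fixing every `det(∑ cᵢXᵢ)` are `I_m ⊗ C` -/

/-- `∑ᵢ δ_{ip} Zᵢ = Z_p` for tuples. [folklore] -/
private theorem sum_single_smul' (Z : Tuple n m) (p : Fin m) :
    ∑ i, (Pi.single p (1 : ℂ) : Fin m → ℂ) i • Z i = Z p := by
  rw [Finset.sum_eq_single p]
  · rw [Pi.single_eq_same, one_smul]
  · intro i _ hip
    rw [Pi.single_eq_of_ne hip, zero_smul]
  · intro h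
    exact absurd (Finset.mem_univ p) h

/-- **MW Prop. 11.1 (the group `G_D`)**: a linear map `g` of `Mat_n^m` (`m ≥ 1`) fixing every
determinantal polynomial `det(∑ᵢ cᵢXᵢ)` is `I_m ⊗ C` for a linear determinant preserver `C` of
`Mat_n`: "`G_D = {I_m ⊗ C | C ∈ G_det}`" (the source states it for invertible `g`; invertibility is
not needed). [cite: MakamWigderson2021, Prop. 11.1] -/
theorem exists_block_of_det_pencil_eq (hm : 1 ≤ m) (g : Tuple n m →ₗ[ℂ] Tuple n m)
    (hg : ∀ (c : Fin m → ℂ) (X : Tuple n m), (∑ i, c i • g X i).det = (∑ i, c i • X i).det) :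
    ∃ C : Matrix (Fin n) (Fin n) ℂ →ₗ[ℂ] Matrix (Fin n) (Fin n) ℂ,
      (∀ W, (C W).det = W.det) ∧ ∀ (X : Tuple n m) (i : Fin m), g X i = C (X i) := by
  -- the blocks `g_{ij} : W ↦ (g (0,…,W,…,0))ᵢ` (`W` in position `j`)
  let blk : Fin m → Fin m → (Matrix (Fin n) (Fin n) ℂ →ₗ[ℂ] Matrix (Fin n) (Fin n) ℂ) :=
    fun i j => LinearMap.proj i ∘ₗ g ∘ₗ LinearMap.single ℂ (fun _ : Fin m => Matrix (Fin n) (Fin n) ℂ) j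
  have hblk : ∀ i j W, blk i j W = g (Pi.single j W) i := fun i j W => rfl
  -- `(gX)ᵢ = ∑ⱼ g_{ij}(Xⱼ)`
  have hdecomp : ∀ (X : Tuple n m) (i : Fin m), g X i = ∑ j, blk i j (X j) := by
    intro X i
    conv_lhs => rw [← Finset.univ_sum_single X]
    rw [map_sum, Finset.sum_apply]
    exact Finset.sum_congr rfl fun j _ => rfl
  -- (1) diagonal blocks preserve the determinant
  have hdiag : ∀ j W, (blk j j W).det = W.det := by
    intro j W
    have h := hg (Pi.single j 1) (Pi.single j W)
    rwa [sum_single_smul', sum_single_smul', Pi.single_eq_same] at h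
  -- (2) off-diagonal blocks vanish
  have hoff : ∀ i j, i ≠ j → ∀ W, blk i j W = 0 := by
    intro i j hij W
    -- `det(g_{ii} Y + g_{ij} W) = det Y` for all `Y`
    have hpair : ∀ Y, (blk i i Y + blk i j W).det = Y.det := by
      intro Y
      have h := hg (Pi.single i 1) (Pi.single i Y + Pi.single j W)
      rw [sum_single_smul', sum_single_smul', map_add, Pi.add_apply, Pi.add_apply,
        Pi.single_eq_same, Pi.single_eq_of_ne hij, add_zero] at h
      exact h
    refine eq_zero_of_forall_det_add_eq fun Y' => ?_
    obtain ⟨Y, rfl⟩ := surjective_of_det_eq (hdiag i) Y'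
    rw [add_comm, hpair, hdiag]
  -- (3) the diagonal blocks agree
  have hsame : ∀ i j, blk i i = blk j j := by
    intro i j
    by_cases hij : i = j
    · rw [hij]
    -- `det(g_{ii} Y + g_{jj} W) = det(Y + W)` for all `Y`, `W`
    have hsum : ∀ Y W, (blk i i Y + blk j j W).det = (Y + W).det := by
      intro Y W
      have h := hg (Pi.single i 1 + Pi.single j 1) (Pi.single i Y + Pi.single j W)
      have hl : ∑ k, (Pi.single i (1 : ℂ) + Pi.single j 1 : Fin m → ℂ) k •
          g (Pi.single i Y + Pi.single j W) k = blk i i Y + blk j j W := by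
        simp only [Pi.add_apply, add_smul, Finset.sum_add_distrib, sum_single_smul', map_add,
          ← hblk]
        rw [hoff i j hij, hoff j i (Ne.symm hij), add_zero, zero_add]
      have hr : ∑ k, (Pi.single i (1 : ℂ) + Pi.single j 1 : Fin m → ℂ) k •
          (Pi.single i Y + Pi.single j W : Tuple n m) k = Y + W := by
        simp only [Pi.add_apply, add_smul, Finset.sum_add_distrib, sum_single_smul',
          Pi.single_eq_same, Pi.single_eq_of_ne hij, Pi.single_eq_of_ne (Ne.symm hij), add_zero,
          zero_add]
      rw [hl, hr] at h
      exact h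
    apply LinearMap.ext
    intro Y
    have hzero : (blk i i - blk j j) Y = 0 := by
      refine eq_zero_of_forall_det_add_eq fun Z => ?_
      obtain ⟨W₀, hW₀⟩ := surjective_of_det_eq (hdiag j) Z
      have h := hsum Y (W₀ - Y)
      rw [map_sub, hW₀, add_sub_cancel] at h
      rw [LinearMap.sub_apply]
      have hmat : blk i i Y - blk j j Y + Z = blk i i Y + (Z - blk j j Y) := by abel
      rw [hmat, h, ← hW₀, hdiag]
    rwa [LinearMap.sub_apply, sub_eq_zero] at hzero
  refine ⟨blk ⟨0, hm⟩ ⟨0, hm⟩, hdiag _, fun X i => ?_⟩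
  rw [hdecomp, Finset.sum_eq_single i]
  · rw [hsame i ⟨0, hm⟩]
  · intro j _ hji
    exact hoff i j (Ne.symm hji) (X j)
  · intro h
    exact absurd (Finset.mem_univ i) h

/-! ### The separating invariant `F = det(∑ Xᵢ ⊗ Tᵢ) · det(∑ Xᵢ ⊗ Tᵢᵀ)` -/

/-- Evaluating the symbolic blow-up determinant `det(∑ᵢ Xᵢ ⊗ Tᵢ) ∈ ℂ[Mat_n^m]` at a tuple.
[cite: MakamWigderson2021, §11 (proof of Thm. 1.16)] -/
theorem eval_det_sum_kronecker (T : Fin m → Matrix (Fin 2) (Fin 2) ℂ) (X : Tuple n m) :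
    MvPolynomial.eval (coords X)
        (∑ i, Matrix.kroneckerMap (· * ·) (varMatrix n m i) ((T i).map MvPolynomial.C)).det =
      (∑ i, Matrix.kroneckerMap (· * ·) (X i) (T i)).det := by
  rw [RingHom.map_det, RingHom.mapMatrix_apply]
  congr 1
  ext ⟨a, p⟩ ⟨b, q⟩
  simp [Matrix.sum_apply, Matrix.kroneckerMap_apply, varMatrix, coords]

/-- Evaluating a determinantal polynomial `det(∑ᵢ cᵢXᵢ)` at a tuple.
[cite: MakamWigderson2021, §1.3 (p0007:L1)] -/
theorem eval_detPencilPoly (c : Fin m → ℂ) (X : Tuple n m) :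
    MvPolynomial.eval (coords X) (detPencilPoly n m c) = (∑ i, c i • X i).det := by
  rw [detPencilPoly, RingHom.map_det, RingHom.mapMatrix_apply]
  congr 1
  ext a b
  simp [Matrix.sum_apply, Matrix.smul_apply, varMatrix, coords]

/-- A sandwich `Xᵢ ↦ P Xᵢ Q` multiplies `det(∑ Xᵢ ⊗ Tᵢ)` by `(det P · det Q)²`.
[cite: MakamWigderson2021, §11 (proof of Thm. 1.16)] -/
theorem det_sum_kronecker_sandwich (P Q : Matrix (Fin n) (Fin n) ℂ) (X : Tuple n m)
    (T : Fin m → Matrix (Fin 2) (Fin 2) ℂ) :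
    (∑ i, Matrix.kroneckerMap (· * ·) (P * X i * Q) (T i)).det =
      (P.det * Q.det) ^ 2 * (∑ i, Matrix.kroneckerMap (· * ·) (X i) (T i)).det := by
  have h : ∑ i, Matrix.kroneckerMap (· * ·) (P * X i * Q) (T i) =
      Matrix.kroneckerMap (· * ·) P (1 : Matrix (Fin 2) (Fin 2) ℂ) *
        (∑ i, Matrix.kroneckerMap (· * ·) (X i) (T i)) *
        Matrix.kroneckerMap (· * ·) Q (1 : Matrix (Fin 2) (Fin 2) ℂ) := by
    rw [Finset.mul_sum, Finset.sum_mul]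
    refine Finset.sum_congr rfl fun i _ => ?_
    rw [← Matrix.mul_kronecker_mul, ← Matrix.mul_kronecker_mul, Matrix.one_mul, Matrix.mul_one]
  rw [h, det_mul, det_mul, det_kronecker, det_kronecker]
  simp only [det_one, one_pow, mul_one, Fintype.card_fin]
  ring

/-- Transposing the tuple moves the transpose onto the blocks: `det(∑ Xᵢᵀ ⊗ Tᵢ) = det(∑ Xᵢ ⊗ Tᵢᵀ)`.
[cite: MakamWigderson2021, §11 (proof of Thm. 1.16)] -/
theorem det_sum_kronecker_transpose (X : Tuple n m) (T : Fin m → Matrix (Fin 2) (Fin 2) ℂ) :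
    (∑ i, Matrix.kroneckerMap (· * ·) (X i)ᵀ (T i)).det =
      (∑ i, Matrix.kroneckerMap (· * ·) (X i) (T i)ᵀ).det := by
  have h : ∑ i, Matrix.kroneckerMap (· * ·) (X i)ᵀ (T i) =
      (∑ i, Matrix.kroneckerMap (· * ·) (X i) (T i)ᵀ)ᵀ := by
    rw [transpose_sum]
    refine Finset.sum_congr rfl fun i _ => ?_
    rw [← kroneckerMap_transpose, transpose_transpose]
  rw [h, det_transpose]

/-- Elements of the ring `D = ℂ[det(∑ cᵢXᵢ)]` take the same value at `0` and at every point of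
`SING_{n,m}` (`n ≥ 1`: all generators vanish at both). [cite: MakamWigderson2021, §11 (proof of Thm. 1.16)] -/
theorem eval_eq_eval_zero_of_mem_adjoin (hn : 1 ≤ n) {X : Tuple n m} (hX : X ∈ SING n m)
    {f : MvPolynomial (Fin m × Fin n × Fin n) ℂ}
    (hf : f ∈ Algebra.adjoin ℂ (Set.range (detPencilPoly n m))) :
    MvPolynomial.eval (coords X) f = MvPolynomial.eval (coords (0 : Tuple n m)) f := by
  haveI : Nonempty (Fin n) := ⟨⟨0, hn⟩⟩
  induction hf using Algebra.adjoin_induction with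
  | mem f hf =>
    obtain ⟨c, rfl⟩ := hf
    rw [eval_detPencilPoly, eval_detPencilPoly, (mem_SING_iff_forall_det_eq_zero X).mp hX c]
    have h0 : ∑ i, c i • (0 : Tuple n m) i = 0 := by simp
    rw [h0, det_zero]
  | algebraMap r => simp
  | add f g _ _ hf hg => rw [map_add, map_add, hf, hg]
  | mul f g _ _ hf hg => rw [map_mul, map_mul, hf, hg]

end MakamWigderson

/-! ### The discharge -/

open MakamWigderson Literature.NumberTheory.DiophantineGeometry in
/-- **MW 2021, Thm. 1.16 — `makamWigderson2021_thm_1_16` holds**: for `n, m ≥ 3` the ring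
`ℂ[{det(∑ᵢ cᵢXᵢ)}]` is not the invariant ring of any linear action of any group on `Mat_n^m`.
[cite: MakamWigderson2021, Thm. 1.16] -/
theorem makamWigderson2021_thm_1_16_holds : makamWigderson2021_thm_1_16 := by
  intro n m hn hm Γ _ ρ heq
  haveI : Nonempty (Fin n × Fin 2) := ⟨(⟨0, by omega⟩, 0)⟩
  obtain ⟨X', hX'S, T, hT1, hT2⟩ := exists_mem_SING_det_kronecker_ne_zero hn hm
  -- the separating polynomial `F`
  set F : MvPolynomial (Fin m × Fin n × Fin n) ℂ :=
    (∑ i, Matrix.kroneckerMap (· * ·) (varMatrix n m i) ((T i).map MvPolynomial.C)).det *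
      (∑ i, Matrix.kroneckerMap (· * ·) (varMatrix n m i) ((T i)ᵀ.map MvPolynomial.C)).det
    with hFdef
  have hFeval : ∀ X : Tuple n m, MvPolynomial.eval (coords X) F =
      (∑ i, Matrix.kroneckerMap (· * ·) (X i) (T i)).det *
        (∑ i, Matrix.kroneckerMap (· * ·) (X i) (T i)ᵀ).det := by
    intro X
    rw [hFdef, map_mul, eval_det_sum_kronecker, eval_det_sum_kronecker (fun i => (T i)ᵀ)]
  -- (1) every `ρ γ` fixes every determinantal polynomial
  have hpencil : ∀ (γ : Γ) (c : Fin m → ℂ) (X : Tuple n m),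
      (∑ i, c i • (((ρ γ : LinearMap.GeneralLinearGroup ℂ (Tuple n m)) :
        Tuple n m →ₗ[ℂ] Tuple n m) X) i).det = (∑ i, c i • X i).det := by
    intro γ c X
    have hmem : detPencilPoly n m c ∈ invariantSubalgebra ρ := by
      rw [heq]
      exact Algebra.subset_adjoin ⟨c, rfl⟩
    have h := hmem γ X
    rwa [eval_detPencilPoly, eval_detPencilPoly] at h
  -- (2) `F` is invariant: `ρ γ = I ⊗ C`, `C` a sandwich or a transposed sandwich
  have hFinv : F ∈ invariantSubalgebra ρ := by
    intro γ X
    obtain ⟨C, hCdet, hC⟩ := exists_block_of_det_pencil_eq (by omega)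
      ((ρ γ : LinearMap.GeneralLinearGroup ℂ (Tuple n m)) : Tuple n m →ₗ[ℂ] Tuple n m) (hpencil γ)
    obtain ⟨P, Q, hP, hQ, hPQ⟩ := MarcusMoyls.exists_unimodular_sandwich_of_det_eq C hCdet
    rw [hFeval, hFeval]
    rcases hPQ with h | h
    · have hρ : ∀ i, ((ρ γ : LinearMap.GeneralLinearGroup ℂ (Tuple n m)) :
          Tuple n m →ₗ[ℂ] Tuple n m) X i = P * X i * Q := fun i => by rw [hC, h]
      simp_rw [hρ]
      rw [det_sum_kronecker_sandwich, det_sum_kronecker_sandwich, hP, hQ, mul_one, one_pow,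
        one_mul, one_mul]
    · have hρ : ∀ i, ((ρ γ : LinearMap.GeneralLinearGroup ℂ (Tuple n m)) :
          Tuple n m →ₗ[ℂ] Tuple n m) X i = P * (X i)ᵀ * Q := fun i => by rw [hC, h]
      simp_rw [hρ]
      rw [det_sum_kronecker_sandwich P Q (fun i => (X i)ᵀ),
        det_sum_kronecker_sandwich P Q (fun i => (X i)ᵀ), hP, hQ, mul_one, one_pow, one_mul,
        one_mul, det_sum_kronecker_transpose, det_sum_kronecker_transpose]
      simp_rw [transpose_transpose]
      rw [mul_comm]
  -- (3) so `F ∈ D`, hence `F(X') = F(0) = 0`; but `F(X') ≠ 0`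
  have hFD : F ∈ Algebra.adjoin ℂ (Set.range (detPencilPoly n m)) := heq ▸ hFinv
  have h := eval_eq_eval_zero_of_mem_adjoin (by omega) hX'S hFD
  rw [hFeval, hFeval] at h
  have h0 : (∑ i, Matrix.kroneckerMap (· * ·) ((0 : Tuple n m) i) (T i)).det = 0 := by
    have : ∑ i, Matrix.kroneckerMap (· * ·) ((0 : Tuple n m) i) (T i) = 0 := by
      refine Finset.sum_eq_zero fun i _ => ?_
      ext ⟨a, p⟩ ⟨b, q⟩
      simp [Matrix.kroneckerMap_apply]
    rw [this, det_zero]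
  rw [h0, zero_mul] at h
  exact mul_ne_zero hT1 hT2 h

end Literature.Computability.AlgebraicComplexity

end
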